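import Summits.ResolutionOfSingularities.ResolutionOfSingularities.Theorems.EquisingularLiftEquisingularLiftNatNoseThenPointsHorizIntrinsic
import HarnessLib

/-!
# [OURS · L1 W4.5(b) · EL♮] ZERO POINT STEPS, EMBEDDED FORM: «every blow-up of `H` along `Λ · 𝒪_H` is regular ⇒ the strict transform
# of `ι(H)` in `Bl_Λ P` is point-resolvable with no point steps» — the non-vacuity tool for the registered (embedded) downstairs clause

Cell `res-hironaka`, rung L, slot W4.5(b); crux EL♮ (stmt-ResolutionOfSingularities-20038) / EL♮(3) (stmt-…-20148), line `sections`; helper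
`--supports … --as helper` by res-type-051 (g14). OURS; NOT a statement of any manuscript; AI-written, weaker than expert review. No definition,
no `sorry`, standard axioms.

The registered stubs T-ISO-0 / v6-NONISO (`stub_elnat_ciNoseThenPoints`) state their downstairs hypothesis in the EMBEDDED form: a blow-up
`υ : F₂ → ℙⁿ_k` of the AMBIENT along the centre, then the PtChain ∃-form from `(F₂, 𝟙, closure υ⁻¹(ι(H) ∖ V(Λ)))` ending with a regular
reduced strict transform. Specimen authors (R2 Whitney cubic `…NatSpecimenWhitneyCubicCharts.isRegular_of_isBlowup_comap`, res-D-pv-027's (L2))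
prove the INTRINSIC statement «every (some) blow-up of `H` along `Λ · 𝒪_H` is regular». This file bridges the two with ZERO point steps:

* `isRegular_reducedStrictTransform_of_forall_isRegular_blowup` — for `ι : H → P` a closed immersion of an integral scheme into a locally
  Noetherian `P`, `Λ` with `ι(H) ⊄ V(Λ)`, and `υ : F₂ → P` a blow-up along `Λ`: if EVERY blow-up of `H` along `Λ.comap ι` is regular, the
  reduced strict transform `V(closure υ⁻¹(ι(H) ∖ V(Λ)))_red ⊆ F₂` is regular (it IS such a blow-up: Stacks 080E via
  `exists_isBlowup_reducedStrictTransform` + `H ≅ V(ι(H))_red`);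
* `embedded_pointResolvable_of_forall_isRegular_blowup` — hence the PtChain ∃-form for `(F₂, closure υ⁻¹(ι(H) ∖ V(Λ)))` holds with
  `(F′, ρ′, T′) = (F₂, 𝟙, ·)` — the `hdown` block of `elNatBody_of_noseThenPoints` / of the registered v6-NONISO stub, verbatim.

References: [StacksProject, Tag 080E]; …ReducedStrictTransformBlowup.lean (p167331); …NatNoseThenPointsHorizIntrinsic.lean (p518889).
-/

set_option linter.dupNamespace false -- mandated namespace `Summit.<Summit>.<Problem>` of this single-conjunct summit

noncomputable section

open CategoryTheory CategoryTheory.Limits AlgebraicGeometry TopologicalSpace Topology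
open Literature.AlgebraicGeometry.Resolution
open AlgebraicGeometry.Scheme.IdealSheafData
open Summit.ResolutionOfSingularities.ResolutionOfSingularities.Theses.EquisingularLift.Split
open Summit.ResolutionOfSingularities.ResolutionOfSingularities.Cruxes.EquisingularLift.StrataSplit

namespace Summit.ResolutionOfSingularities.ResolutionOfSingularities.Cruxes.EquisingularLiftNat.Sections

/-- **The reduced strict transform is regular when every blow-up of `H` along `Λ · 𝒪_H` is.** `P` locally Noetherian, `ι : H → P` a closed
immersion of an integral scheme, `Λ` an ideal sheaf with `ι(H) ⊄ V(Λ)`, `υ : F₂ → P` a blow-up along `Λ`. The reduced closed subscheme of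
`F₂` on `closure υ⁻¹(ι(H) ∖ V(Λ))` is a blow-up of `V(ι(H))_red ≅ H` along the trace of `Λ` (Stacks 080E), so the hypothesis applies to it.
[cite: StacksProject, Tag 080E] -/
theorem isRegular_reducedStrictTransform_of_forall_isRegular_blowup {P : Scheme.{0}} [IsLocallyNoetherian P] {H : Scheme.{0}}
    [IsIntegral H] (ι : H ⟶ P) [IsClosedImmersion ι] (Λ : P.IdealSheafData)
    (hgen : ¬ (Set.range ι ⊆ (Λ.support : Set P)))
    (hreg : ∀ (Z : Scheme.{0}) (ρ : Z ⟶ H), IsBlowup ρ (Λ.comap ι) → Scheme.IsRegular Z)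
    (F₂ : Scheme.{0}) (υ : F₂ ⟶ P) (hυ : IsBlowup υ Λ) :
    Scheme.IsRegular (vanishingIdeal (⟨closure (υ ⁻¹' (Set.range ι \ (Λ.support : Set P))), isClosed_closure⟩ : Closeds F₂)).subscheme := by
  haveI : IsProper υ := hυ.isProper
  haveI : IsLocallyNoetherian F₂ := LocallyOfFiniteType.isLocallyNoetherian υ
  -- `H ≅ V(ι(H))_red`, compatibly with the embeddings
  have hιirr : IsIrreducible (Set.range ι) := by
    have h := (IrreducibleSpace.isIrreducible_univ H).image ι ι.continuous.continuousOn
    rwa [Set.image_univ] at h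
  let TD : Closeds P := ⟨Set.range ι, ι.isClosedEmbedding.isClosed_range⟩
  have hDker : vanishingIdeal TD = ι.ker := by
    rw [← Scheme.IdealSheafData.map_bot, ← Scheme.nilradical_eq_bot, ← Scheme.IdealSheafData.vanishingIdeal_top,
      Scheme.IdealSheafData.map_vanishingIdeal]
    congr 1
    ext1
    change Set.range ι = closure (ι '' Set.univ)
    rw [Set.image_univ, ι.isClosedEmbedding.isClosed_range.closure_eq]
  have hkerD : (vanishingIdeal TD).subschemeι.ker = ι.ker := by
    rw [Scheme.IdealSheafData.ker_subschemeι, hDker]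
  let eD : H ⟶ (vanishingIdeal TD).subscheme := IsClosedImmersion.lift _ ι hkerD.le
  have heD : eD ≫ (vanishingIdeal TD).subschemeι = ι := IsClosedImmersion.lift_fac _ ι hkerD.le
  haveI : IsIso eD := IsClosedImmersion.isIso_lift _ ι hkerD
  -- the reduced strict transform is a blow-up of `V(ι(H))_red` along the trace of `Λ` (Stacks 080E), hence of `H` along `Λ.comap ι`
  obtain ⟨ρD, -, -, hρD⟩ := exists_isBlowup_reducedStrictTransform P F₂ υ Λ hυ (Set.range ι) ι.isClosedEmbedding.isClosed_range hιirr hgen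
  have hb := hρD.comp_iso (asIso eD).symm
  have hcomap : (Λ.comap (vanishingIdeal TD).subschemeι).comap (asIso eD).symm.inv = Λ.comap ι := by
    rw [← Scheme.IdealSheafData.comap_comp]
    change Λ.comap (eD ≫ (vanishingIdeal TD).subschemeι) = Λ.comap ι
    rw [heD]
  rw [hcomap] at hb
  exact hreg _ _ hb

/-- **ZERO POINT STEPS, EMBEDDED FORM.** Under the hypotheses of `isRegular_reducedStrictTransform_of_forall_isRegular_blowup`, the PtChain ∃-form
of the registered stubs' downstairs clause holds for `(F₂, closure υ⁻¹(ι(H) ∖ V(Λ)))` — witnessed by `(F′, ρ′, T′) = (F₂, 𝟙, closure υ⁻¹(ι(H) ∖ V(Λ)))`,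
whose reduced closure is regular. This is the `hdown` block of `elNatBody_of_noseThenPoints` (p513523) and of `stub_elnat_ciNoseThenPoints`
(with `Λ = vanishingIdeal Σ`), so «every blow-up of `H` along `Λ · 𝒪_H` is regular» certifies that clause. [cite: StacksProject, Tag 080E] -/
theorem embedded_pointResolvable_of_forall_isRegular_blowup {P : Scheme.{0}} [IsLocallyNoetherian P] {H : Scheme.{0}}
    [IsIntegral H] (ι : H ⟶ P) [IsClosedImmersion ι] (Λ : P.IdealSheafData)
    (hgen : ¬ (Set.range ι ⊆ (Λ.support : Set P)))
    (hreg : ∀ (Z : Scheme.{0}) (ρ : Z ⟶ H), IsBlowup ρ (Λ.comap ι) → Scheme.IsRegular Z)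
    (F₂ : Scheme.{0}) (υ : F₂ ⟶ P) (hυ : IsBlowup υ Λ) :
    ∃ (F' : Scheme.{0}) (ρ' : F' ⟶ F₂) (T' : Set F'),
      (∀ Q : (∀ F₁ : Scheme.{0}, (F₁ ⟶ F₂) → Set F₁ → Prop),
        Q F₂ (𝟙 F₂) (closure (υ ⁻¹' (Set.range ι \ (Λ.support : Set P)))) →
        (∀ (F₁ F₃ : Scheme.{0}) (ρ : F₁ ⟶ F₂) (T₁ : Set F₁)
          (x : ↥(vanishingIdeal (⟨closure T₁, isClosed_closure⟩ : Closeds F₁)).subscheme) (υ₁ : F₃ ⟶ F₁)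
          (hx : IsClosed ({((vanishingIdeal (⟨closure T₁, isClosed_closure⟩ : Closeds F₁)).subschemeι x : F₁)} : Set F₁)),
          Q F₁ ρ T₁ →
          ¬ IsRegularLocalRing ((vanishingIdeal (⟨closure T₁, isClosed_closure⟩ : Closeds F₁)).subscheme.presheaf.stalk x) →
          IsBlowup υ₁ (vanishingIdeal
            (⟨{((vanishingIdeal (⟨closure T₁, isClosed_closure⟩ : Closeds F₁)).subschemeι x : F₁)}, hx⟩ : Closeds F₁)) →
          Q F₃ (υ₁ ≫ ρ) (closure (υ₁ ⁻¹' (T₁ \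
            {((vanishingIdeal (⟨closure T₁, isClosed_closure⟩ : Closeds F₁)).subschemeι x : F₁)})))) →
        Q F' ρ' T') ∧
      Scheme.IsRegular (vanishingIdeal (⟨closure T', isClosed_closure⟩ : Closeds F')).subscheme := by
  refine ⟨F₂, 𝟙 F₂, closure (υ ⁻¹' (Set.range ι \ (Λ.support : Set P))), fun Q h0 _ => h0, ?_⟩
  have hcl : (⟨closure (closure (υ ⁻¹' (Set.range ι \ (Λ.support : Set P)))), isClosed_closure⟩ : Closeds F₂) =
      ⟨closure (υ ⁻¹' (Set.range ι \ (Λ.support : Set P))), isClosed_closure⟩ := Closeds.ext (by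
    change closure (closure _) = closure _
    rw [closure_closure])
  rw [hcl]
  exact isRegular_reducedStrictTransform_of_forall_isRegular_blowup ι Λ hgen hreg F₂ υ hυ

end Summit.ResolutionOfSingularities.ResolutionOfSingularities.Cruxes.EquisingularLiftNat.Sections

end
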